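import Mathlib
import Literature.NumberTheory.Transcendental.KZProduct
import Literature.NumberTheory.Transcendental.KZProductIdeal
import Literature.NumberTheory.Transcendental.KZRulesAssociator
import Summits.KontsevichZagierPeriods.KontsevichZagierPeriods.Theorems.SoloInformedLadderSplit
import Summits.KontsevichZagierPeriods.KontsevichZagierPeriods.Theorems.SoloInformedKummerBox
import Summits.KontsevichZagierPeriods.KontsevichZagierPeriods.Theorems.SoloInformedDilation
import Summits.KontsevichZagierPeriods.KontsevichZagierPeriods.Theorems.SoloInformedTorusInstance
import Summits.KontsevichZagierPeriods.KontsevichZagierPeriods.Theorems.SoloInformedTorusBoxLogic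
import HarnessLib
import HarnessLib.Audit

/-!
# SoloInformed — the Theorem II instance needs only the LOCALISED volume rung

`SoloInformedTorusBoxLogic` typed the instance `T₀` versus `B(2,3)` against the volume rung
`SoloInformedVolumeRung 3`. The volume ladder splits as `Rung_d ⟺ LocRung_d ∧ DiscCanc_d`
(`SoloInformedLadderSplit`), and the transcendence content of the instance already sits in the LOCALISED
rung `SoloInformedLocVolumeRung 3` ("equal volumes ⇒ equal formal periods after multiplication by a power
of `⟦[π]⟧`"): this file proves

* `SoloInformedLocVolumeRung 3 → (SoloInformedTorusBoxNoLocRelation ↔ SoloInformedC4EW23)`, where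
  `SoloInformedTorusBoxNoLocRelation` says `⟦[π]⟧ⁿ · ⟦p·[D̄]·[D̄] − q·[L₂]·[L₃]⟧ ≠ 0` in the formal period
  ring for all `n` and all `p, q ≥ 1` (proved ON PAPER in the residency paper, §3, by the same argument as the
  un-localised statement: the comparison map to Nori's formal periods sends `⟦[π]⟧` to a unit times `2πi`);
* `SoloInformedC4EW23 → SoloInformedTorusBoxNoLocRelation` unconditionally (`evalP`, `π ≠ 0`);
* `SoloInformedTorusBoxNoLocRelation → SoloInformedTorusBoxNoRelation` (`n = 0`).

So disc cancellation plays no role in Theorem II: `LocRung_3 ⇒ (C4EW)(2,3)` granted the paper's §3, and the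
geometric statement `LocRung_3` — strictly weaker than `Rung_3` unless `KZ.PiCancellation` holds — already has
open transcendence content.

Residency `solo-KontsevichZagierPeriods-informed` (PLAN.md, session s16).
References: M. Kontsevich, D. Zagier, *Periods* (2001), §1.2, §4.1; Yu. Nesterenko, P. Philippon (eds.),
*Introduction to Algebraic Independence Theory*, LNM 1752 (2001), Ch. 2 §4.1.
-/

noncomputable section

namespace Summit.KontsevichZagierPeriods.KontsevichZagierPeriods.Theorems

open Literature.NumberTheory.Transcendental Literature.NumberTheory.Transcendental.KZ

/-- **No localised relation** (proved ON PAPER, §3 of the residency paper; a hypothesis here): for all `n`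
and all `p, q ≥ 1`, `⟦[π]⟧ⁿ · ⟦p·[D̄]·[D̄] − q·[L₂]·[L₃]⟧ ≠ 0` in the formal period ring
`FormalRep ⧸ relations`. -/
@[conjecture] def SoloInformedTorusBoxNoLocRelation : Prop :=
  ∀ n p q : ℕ, p ≠ 0 → q ≠ 0 →
    toFormalPeriod (of piRep) ^ n *
      toFormalPeriod (p • (of piRep * of piRep) -
        q • (of (soloInformedKummerRep 2) * of (soloInformedKummerRep 3))) ≠ 0

/-- **(1)** `(C4EW)(2,3)` implies the localised non-relation, unconditionally: apply `evalP` and cancel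
`πⁿ ≠ 0`. -/
theorem soloInformed_noLocRelation_of_c4ew (h : SoloInformedC4EW23) :
    SoloInformedTorusBoxNoLocRelation := by
  intro n p q hp hq h0
  have h1 := congrArg evalP h0
  rw [map_mul, map_pow, evalP_toFormalPeriod_of, piRep_value, evalP_toFormalPeriod,
    soloInformed_eval_torusBox_combination, map_zero] at h1
  rcases mul_eq_zero.mp h1 with h2 | h2
  · exact pow_ne_zero n Real.pi_pos.ne' h2
  · exact h p q hp hq (by linarith)

/-- The localised non-relation implies the plain one (`n = 0`). -/
theorem soloInformed_noRelation_of_noLocRelation (h : SoloInformedTorusBoxNoLocRelation) :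
    SoloInformedTorusBoxNoRelation := by
  intro p q hp hq hmem
  apply h 0 p q hp hq
  rw [pow_zero, one_mul, toFormalPeriod_eq_zero_iff]
  exact hmem

/-- **(2)** Granting the LOCALISED volume rung `3`, the localised non-relation implies `(C4EW)(2,3)`:
a numerical relation `p·π² = q·log 2·log 3` makes the dilates `Φ_p T₀`, `Φ_q B(2,3)` equal-volume solids,
the localised rung gives `⟦[π]⟧ⁿ·⟦Φ_p T₀⟧ = ⟦[π]⟧ⁿ·⟦Φ_q B(2,3)⟧` for some `n`, and
`⟦Φ_p T₀⟧ = ⟦p·[D̄]·[D̄]⟧`, `⟦Φ_q B(2,3)⟧ = ⟦q·[L₂]·[L₃]⟧` unconditionally. -/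
theorem soloInformed_c4ew_of_locRung_three_of_noLocRelation (h3 : SoloInformedLocVolumeRung 3)
    (hN : SoloInformedTorusBoxNoLocRelation) : SoloInformedC4EW23 := by
  intro p q hp hq hrel
  have hB := soloInformed_kummerBoxRep_isVolume 2 3 le_rfl (by norm_num)
  have hT1 : ∀ x ∈ soloInformedTorusRep.domain, soloInformedTorusRep.integrand x = 1 := fun _ _ => rfl
  have hKvol : SoloInformedIsVolumeRep
      (soloInformedStretchRep soloInformedTorusRep isCompact_soloInformedTorusRep_domain p) :=
    ⟨isCompact_soloInformedStretchRep_domain _ _ p,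
      soloInformed_interior_stretchRep_nonempty _ _ p hp soloInformed_interior_torusRep_nonempty,
      fun _ _ => rfl⟩
  have hK'vol : SoloInformedIsVolumeRep (soloInformedStretchRep (soloInformedKummerBoxRep 2 3) hB.1 q) :=
    ⟨isCompact_soloInformedStretchRep_domain _ _ q,
      soloInformed_interior_stretchRep_nonempty _ _ q hq hB.2.1, fun _ _ => rfl⟩
  have hv : (soloInformedStretchRep soloInformedTorusRep isCompact_soloInformedTorusRep_domain p).value
      = (soloInformedStretchRep (soloInformedKummerBoxRep 2 3) hB.1 q).value := by
    rw [soloInformed_value_stretchRep _ _ hT1 p hp, soloInformed_value_stretchRep _ _ hB.2.2 q hq,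
      soloInformed_value_torusRep, soloInformed_value_kummerBoxRep 2 3 (by norm_num) (by norm_num)]
    exact_mod_cast hrel
  obtain ⟨n, hn⟩ := h3 _ _ hKvol hK'vol hv
  have hS := soloInformed_stretchRep_sub_nsmul_mem_relations soloInformedTorusRep
    isCompact_soloInformedTorusRep_domain hT1 p hp
  have hS' := soloInformed_stretchRep_sub_nsmul_mem_relations (soloInformedKummerBoxRep 2 3) hB.1
    hB.2.2 q hq
  have hT := soloInformed_torusRep_sub_piRep_mul_piRep_mem_relations
  have hK := soloInformed_of_kummerBox_sub_mul_mem_relations 2 3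
  have e1 : toFormalPeriod
      (of (soloInformedStretchRep soloInformedTorusRep isCompact_soloInformedTorusRep_domain p)) =
      toFormalPeriod (p • (of piRep * of piRep)) := by
    rw [toFormalPeriod_eq_iff]
    have e : of (soloInformedStretchRep soloInformedTorusRep isCompact_soloInformedTorusRep_domain p) -
        p • (of piRep * of piRep) =
        (of (soloInformedStretchRep soloInformedTorusRep isCompact_soloInformedTorusRep_domain p) -
          p • of soloInformedTorusRep) + p • (of soloInformedTorusRep - of piRep * of piRep) := by
      rw [nsmul_sub]; abel
    rw [e]
    exact relations.add_mem hS (relations.nsmul_mem hT p)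
  have e2 : toFormalPeriod (of (soloInformedStretchRep (soloInformedKummerBoxRep 2 3) hB.1 q)) =
      toFormalPeriod (q • (of (soloInformedKummerRep 2) * of (soloInformedKummerRep 3))) := by
    rw [toFormalPeriod_eq_iff]
    have e : of (soloInformedStretchRep (soloInformedKummerBoxRep 2 3) hB.1 q) -
        q • (of (soloInformedKummerRep 2) * of (soloInformedKummerRep 3)) =
        (of (soloInformedStretchRep (soloInformedKummerBoxRep 2 3) hB.1 q) -
          q • of (soloInformedKummerBoxRep 2 3)) +
        q • (of (soloInformedKummerBoxRep 2 3) -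
          of (soloInformedKummerRep 2) * of (soloInformedKummerRep 3)) := by
      rw [nsmul_sub]; abel
    rw [e]
    exact relations.add_mem hS' (relations.nsmul_mem hK q)
  apply hN n p q hp hq
  rw [map_sub, mul_sub, ← e1, ← e2, hn, sub_self]

/-- **(3)** Granting the localised volume rung `3`, the localised non-relation and `(C4EW)(2,3)` are
equivalent. -/
theorem soloInformed_locRung_three_noLocRelation_iff_c4ew (h3 : SoloInformedLocVolumeRung 3) :
    SoloInformedTorusBoxNoLocRelation ↔ SoloInformedC4EW23 :=
  ⟨soloInformed_c4ew_of_locRung_three_of_noLocRelation h3, soloInformed_noLocRelation_of_c4ew⟩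

/-- The volume-rung form follows from the localised one (`Rung_3 ⇒ LocRung_3`): this recovers
`soloInformed_c4ew_of_rung_three_of_noRelation` with the (formally stronger, paper-proved) localised
hypothesis. -/
theorem soloInformed_c4ew_of_rung_three_of_noLocRelation (h3 : SoloInformedVolumeRung 3)
    (hN : SoloInformedTorusBoxNoLocRelation) : SoloInformedC4EW23 :=
  soloInformed_c4ew_of_locRung_three_of_noLocRelation (soloInformed_locVolumeRung_of_volumeRung h3) hN

end Summit.KontsevichZagierPeriods.KontsevichZagierPeriods.Theorems
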